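/-
Copyright (c) 2026 the pub-hodgecm-mathlib formalisation cell (harness21).  Prover seat hodgecm-mathlib-K2Liu-p10 (g0), Track B «K2-LIT»,
#184♮ = hLiu418 = `stmt-HodgeConjecture-24832`; LEAD F0P6-plan (g12) 07:08:11Z «= NEXT H1-C», SIGS-RoadI-v3 §Hol row H1-C
(K2E5-plan (g5)).  THEOREMS ONLY (no `def`, no `instance`, no named-fact hypothesis, no `sorry`).
-/
import Summits.HodgeConjecture.HodgeConjecture.Theorems.K2LiuHermitianTubeFrame
import Summits.HodgeConjecture.HodgeConjecture.Theorems.K2LiuSiegelUnipotentLocalDefs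
import Literature.NumberTheory.GelbartRogawski1991.LocalKudlaSplittingInjectiveTransported
import Literature.NumberTheory.Automorphic.UnitaryGroupArchimedeanPlaces
import HarnessLib

/-!
# Crux `HLiu418`, Road I, organ Hol-1 (H1-C), arithmetic glue: at a complex place `w` of the CM field `L` the doubled hermitian
# form `J^𝔻 = hermD` IS `diag(t_w) ⊕ −diag(t_w)` with `t_w` REAL and nowhere zero, so the ring-level frame of
# ★ `K2LiuHermitianTubeFrame` carries `U(J^𝔻)(L_w) = archLocal … w` into the tube group `U(J)`, `P_Δ` (★ `IsSiegelM`) into `{C = 0}`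
# and `N_Δ` (★ `IsUnipM`) ONTO the hermitian translations

Cell `hodgecm-mathlib`, crux item hLiu418 = `stmt-HodgeConjecture-24832` (helper lane, count-neutral).
* §1 `hermD_map_embedding`: `σ_w(J^𝔻) = reindex e₂ e₂ (diag t_w ⊕ −diag t_w)`, `t_w k = Re σ_w(dV_{(e⁻¹k).1} dW_{(e⁻¹k).2})`
  (★ `gramR_eq_diagonal`, ★ `hermD_eq_map_reindex_fromBlocks` definitional, realness from ★ `embedding_galConj`), and `t_w k ≠ 0`
  when `dV, dW` are nowhere zero;
* §2 block form of membership: `g ∈ archLocal L (n+n) J^𝔻 w` iff `g̃ᴴ (diag t_w ⊕ −diag t_w) g̃ = (diag t_w ⊕ −diag t_w)` for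
  `g̃ = reindex e₂⁻¹ e₂⁻¹ g` (★ `mem_archLocal_iff_conjTranspose`);
* §3 THE PER-PLACE FRAME PACKAGE `exists_tubeFrame_arch`: `T, T⁻¹` with `T T⁻¹ = 1 = T⁻¹ T` such that for every
  `g ∈ archLocal … w`: `(T g̃ T⁻¹)ᴴ J (T g̃ T⁻¹) = J`; `IsSiegelM g → (T g̃ T⁻¹)₂₁ = 0`; `IsUnipM u → T ũ T⁻¹ = (1 b; 0 1)` with `bᴴ = b`;
  and conversely every hermitian `b` is `T ũ T⁻¹` for some `u ∈ archLocal … w` with `IsUnipM u` — the surjectivity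
  `N_Δ(L⁺_v ⊗ ℝ) ↠ Herm_n(ℂ)` that turns `W_0`-invariance into Hol-2b's (E2).
Sources: [Shimura1997, §§5–6]; [GelbartRogawski1991, §3.1].
HONEST LABEL.  Helper lemmas, count-neutral; `HC_CM` is proved only modulo the 7 printed citations (2 remaining named inputs:
hLiu418 = `stmt-HodgeConjecture-24832`, h413 = `stmt-HodgeConjecture-24833`) until rung 0 closes.
-/

set_option autoImplicit false
set_option linter.dupNamespace false -- the mandated namespace repeats `HodgeConjecture.HodgeConjecture`

namespace Summit.HodgeConjecture.HodgeConjecture.Cruxes.HLiu418.K2LiuHermitianTubeFrameArch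

open Matrix Complex NumberField
open scoped MatrixGroups ComplexConjugate
open Literature.NumberTheory.Automorphic Literature.NumberTheory.Automorphic.UnitaryGroup
open Literature.NumberTheory.GelbartRogawski1991 Literature.NumberTheory.GelbartRogawski1991.GRConstruction
open K2LiuHermitianTubeCocycle K2LiuHermitianTubeFrame K2LiuSiegelUnipotentLocalDefs

variable (L : Type) [Field L] [NumberField L] [IsCMField L] {N M n : ℕ} (e : Fin N × Fin M ≃ Fin n)
  (dV : Fin N → L) (hdV : ∀ i, IsCMField.complexConj L (dV i) = dV i)
  (dW : Fin M → L) (hdW : ∀ i, IsCMField.complexConj L (dW i) = dW i)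
  (w : {w : InfinitePlace L // w.IsComplex})

/-! ## 1. `σ_w(J^𝔻) = diag(t_w) ⊕ −diag(t_w)` with `t_w` real, nowhere zero -/

include hdV hdW in
/-- At a complex place fixed by complex conjugation, `σ_w(dV_i dW_j)` is REAL. [cite: GelbartRogawski1991, §3.1] -/
theorem embedding_dVdW_eq_re (hw : IsCMField.complexConj L • w.1 = w.1) (k : Fin n) :
    w.1.embedding (dV (e.symm k).1 * dW (e.symm k).2) =
      (((w.1.embedding (dV (e.symm k).1 * dW (e.symm k).2)).re : ℝ) : ℂ) := by
  refine (conj_eq_iff_re.1 ?_).symm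
  rw [← embedding_galConj (Fp L) L (IsCMField.complexConj L) w hw (IsCMField.complexConj_ne_one L), map_mul, hdV, hdW]

/-- **`σ_w(J^𝔻) = reindex e₂ e₂ (diag t_w ⊕ −diag t_w)`**, `t_w k = Re σ_w(dV_{(e⁻¹k).1} · dW_{(e⁻¹k).2})`.
[cite: GelbartRogawski1991, §3.1 Prop. 3.1.1] -/
theorem hermD_map_embedding (hw : IsCMField.complexConj L • w.1 = w.1) :
    (hermD L e dV hdV dW hdW).map w.1.embedding =
      Matrix.reindex (e₂ (n := n)) (e₂ (n := n)) (fromBlocks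
        (diagonal fun k => (((w.1.embedding (dV (e.symm k).1 * dW (e.symm k).2)).re : ℝ) : ℂ)) 0 0
        (-diagonal fun k => (((w.1.embedding (dV (e.symm k).1 * dW (e.symm k).2)).re : ℝ) : ℂ))) := by
  have hfun : (fun m => (⇑w.1.embedding ∘ ⇑(algebraMap (Fp L) L))
      ((⟨dV (e.symm m).1, (IsCMField.complexConj_eq_self_iff (K := L) (dV (e.symm m).1)).1 (hdV _)⟩ : Fp L) *
        ⟨dW (e.symm m).2, (IsCMField.complexConj_eq_self_iff (K := L) (dW (e.symm m).2)).1 (hdW _)⟩)) =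
      fun k => (((w.1.embedding (dV (e.symm k).1 * dW (e.symm k).2)).re : ℝ) : ℂ) := by
    funext k
    rw [Function.comp_apply, ← embedding_dVdW_eq_re L e dV hdV dW hdW w hw k]
    rfl
  rw [hermD_eq_map_reindex_fromBlocks, gramR_eq_diagonal, Matrix.map_map, reindex_apply, reindex_apply, ← submatrix_map,
    fromBlocks_map, Matrix.map_zero _ (by simp), Matrix.map_neg _ (fun _ => by simp), diagonal_map (by simp), hfun]

/-- Block form: `reindex e₂⁻¹ e₂⁻¹ σ_w(J^𝔻) = diag(t_w) ⊕ −diag(t_w)`. [cite: GelbartRogawski1991, §3.1 Prop. 3.1.1] -/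
theorem reindex_hermD_map_embedding (hw : IsCMField.complexConj L • w.1 = w.1) :
    Matrix.reindex (e₂ (n := n)).symm (e₂ (n := n)).symm ((hermD L e dV hdV dW hdW).map w.1.embedding) =
      fromBlocks (diagonal fun k => (((w.1.embedding (dV (e.symm k).1 * dW (e.symm k).2)).re : ℝ) : ℂ)) 0 0
        (-diagonal fun k => (((w.1.embedding (dV (e.symm k).1 * dW (e.symm k).2)).re : ℝ) : ℂ)) := by
  rw [hermD_map_embedding L e dV hdV dW hdW w hw, reindex_apply, reindex_apply, submatrix_submatrix, Equiv.symm_symm,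
    Equiv.symm_comp_self, submatrix_id_id]

include hdV hdW in
/-- `t_w k ≠ 0` when `dV`, `dW` are nowhere zero. [cite: GelbartRogawski1991, §3.1 Prop. 3.1.1] -/
theorem tw_ne_zero (hw : IsCMField.complexConj L • w.1 = w.1) (hdV0 : ∀ i, dV i ≠ 0) (hdW0 : ∀ j, dW j ≠ 0) (k : Fin n) :
    (w.1.embedding (dV (e.symm k).1 * dW (e.symm k).2)).re ≠ 0 := by
  intro h
  have h' := embedding_dVdW_eq_re L e dV hdV dW hdW w hw k
  rw [h, ofReal_zero, map_eq_zero] at h'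
  exact mul_ne_zero (hdV0 _) (hdW0 _) h'

/-! ## 2. Membership in block form -/

/-- `reindex` along an equivalence is multiplicative on triple products. [folklore] -/
theorem reindex_mul_mul {m o : Type*} [Fintype m] [Fintype o] (f : m ≃ o) (A B C : Matrix m m ℂ) :
    Matrix.reindex f f (A * B * C) = Matrix.reindex f f A * Matrix.reindex f f B * Matrix.reindex f f C := by
  rw [reindex_apply, reindex_apply, reindex_apply, reindex_apply, ← submatrix_mul_equiv (A * B) C _ f.symm _,
    ← submatrix_mul_equiv A B _ f.symm _]

/-- **Block form of membership**: `g ∈ archLocal L (n+n) J^𝔻 w` iff `g̃ᴴ (diag t_w ⊕ −diag t_w) g̃ = diag t_w ⊕ −diag t_w`,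
`g̃ = reindex e₂⁻¹ e₂⁻¹ g`. [cite: GelbartRogawski1991, §3.1 Prop. 3.1.1] -/
theorem mem_archLocal_hermD_iff (hw : IsCMField.complexConj L • w.1 = w.1) (g : GL (Fin (n + n)) ℂ) :
    g ∈ archLocal L (n + n) (hermD L e dV hdV dW hdW) w ↔
      (Matrix.reindex (e₂ (n := n)).symm (e₂ (n := n)).symm (g : Matrix (Fin (n + n)) (Fin (n + n)) ℂ))ᴴ *
          fromBlocks (diagonal fun k => (((w.1.embedding (dV (e.symm k).1 * dW (e.symm k).2)).re : ℝ) : ℂ)) 0 0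
            (-diagonal fun k => (((w.1.embedding (dV (e.symm k).1 * dW (e.symm k).2)).re : ℝ) : ℂ)) *
        Matrix.reindex (e₂ (n := n)).symm (e₂ (n := n)).symm (g : Matrix (Fin (n + n)) (Fin (n + n)) ℂ) =
      fromBlocks (diagonal fun k => (((w.1.embedding (dV (e.symm k).1 * dW (e.symm k).2)).re : ℝ) : ℂ)) 0 0
        (-diagonal fun k => (((w.1.embedding (dV (e.symm k).1 * dW (e.symm k).2)).re : ℝ) : ℂ)) := by
  rw [mem_archLocal_iff_conjTranspose, ← reindex_hermD_map_embedding L e dV hdV dW hdW w hw, conjTranspose_reindex,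
    ← reindex_mul_mul]
  exact (Matrix.reindex (e₂ (n := n)).symm (e₂ (n := n)).symm).injective.eq_iff.symm

/-! ## 3. The per-place frame package -/

/-- `u(φ) u(−φ) = 1`. [cite: Shimura1997, §6.4] -/
theorem unip_mul_unip_neg {l : Type*} [Fintype l] [DecidableEq l] (φ : Matrix l l ℂ) :
    fromBlocks (1 + φ) (-φ) φ (1 - φ) * fromBlocks (1 - φ) φ (-φ) (1 + φ) = 1 := by
  rw [fromBlocks_multiply, ← fromBlocks_one]
  congr 1 <;> noncomm_ring

/-- `u(−φ) u(φ) = 1`. [cite: Shimura1997, §6.4] -/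
theorem unip_neg_mul_unip {l : Type*} [Fintype l] [DecidableEq l] (φ : Matrix l l ℂ) :
    fromBlocks (1 - φ) φ (-φ) (1 + φ) * fromBlocks (1 + φ) (-φ) φ (1 - φ) = 1 := by
  rw [fromBlocks_multiply, ← fromBlocks_one]
  congr 1 <;> noncomm_ring

/-- The blocks of `reindex e₂⁻¹ e₂⁻¹ (reindex e₂ e₂ M)` are those of `M`. [folklore] -/
theorem reindex_symm_reindex {l : Type*} (f : l ⊕ l ≃ Fin (n + n)) (M : Matrix (l ⊕ l) (l ⊕ l) ℂ) :
    Matrix.reindex f.symm f.symm (Matrix.reindex f f M) = M := by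
  rw [reindex_apply, reindex_apply, submatrix_submatrix, Equiv.symm_symm, Equiv.symm_comp_self, submatrix_id_id]

/-- `IsUnipM` of `reindex e₂ e₂ u(φ)`. [cite: Shimura1997, §6.4] -/
theorem isUnipM_reindex_unip (φ : Matrix (Fin n) (Fin n) ℂ) :
    IsUnipM (n := n) (Matrix.reindex (e₂ (n := n)) (e₂ (n := n)) (fromBlocks (1 + φ) (-φ) φ (1 - φ))) := by
  unfold IsUnipM
  rw [reindex_symm_reindex, toBlocks_fromBlocks₁₁, toBlocks_fromBlocks₁₂, toBlocks_fromBlocks₂₁, toBlocks_fromBlocks₂₂]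
  refine ⟨?_, ?_, ?_⟩ <;> abel

/-- **THE PER-PLACE FRAME PACKAGE (H1-C).**  At a complex place `w` (fixed by `c`), with `dV, dW` nowhere zero, there are
`T, T⁻¹ ∈ M_{2n}(ℂ)`, `T T⁻¹ = 1 = T⁻¹ T`, such that `g ↦ T g̃ T⁻¹` (`g̃ = reindex e₂⁻¹ e₂⁻¹ g`) maps `archLocal L (n+n) J^𝔻 w` into
`{Pᴴ J P = J}`, the Siegel parabolic (`IsSiegelM`) into `{C = 0}`, the unipotent radical (`IsUnipM`) into hermitian translations,
and EVERY hermitian translation is reached from an `IsUnipM` element of `archLocal … w`. [cite: Shimura1997, §§5–6] -/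
theorem exists_tubeFrame_arch (hw : IsCMField.complexConj L • w.1 = w.1) (hdV0 : ∀ i, dV i ≠ 0) (hdW0 : ∀ j, dW j ≠ 0) :
    ∃ T Tinv : Matrix (Fin n ⊕ Fin n) (Fin n ⊕ Fin n) ℂ, T * Tinv = 1 ∧ Tinv * T = 1 ∧
      (∀ g : GL (Fin (n + n)) ℂ, g ∈ archLocal L (n + n) (hermD L e dV hdV dW hdW) w →
        (T * Matrix.reindex (e₂ (n := n)).symm (e₂ (n := n)).symm (g : Matrix _ _ ℂ) * Tinv)ᴴ * Matrix.J (Fin n) ℂ *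
          (T * Matrix.reindex (e₂ (n := n)).symm (e₂ (n := n)).symm (g : Matrix _ _ ℂ) * Tinv) = Matrix.J (Fin n) ℂ) ∧
      (∀ g : GL (Fin (n + n)) ℂ, IsSiegelM (n := n) (g : Matrix (Fin (n + n)) (Fin (n + n)) ℂ) →
        (T * Matrix.reindex (e₂ (n := n)).symm (e₂ (n := n)).symm (g : Matrix _ _ ℂ) * Tinv).toBlocks₂₁ = 0) ∧
      (∀ u : GL (Fin (n + n)) ℂ, u ∈ archLocal L (n + n) (hermD L e dV hdV dW hdW) w → IsUnipM (n := n) (u : Matrix (Fin (n + n)) (Fin (n + n)) ℂ) →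
        ∃ b : Matrix (Fin n) (Fin n) ℂ, bᴴ = b ∧
          T * Matrix.reindex (e₂ (n := n)).symm (e₂ (n := n)).symm (u : Matrix _ _ ℂ) * Tinv = fromBlocks 1 b 0 1) ∧
      (∀ b : Matrix (Fin n) (Fin n) ℂ, bᴴ = b → ∃ u : GL (Fin (n + n)) ℂ,
        u ∈ archLocal L (n + n) (hermD L e dV hdV dW hdW) w ∧ IsUnipM (n := n) (u : Matrix (Fin (n + n)) (Fin (n + n)) ℂ) ∧
          T * Matrix.reindex (e₂ (n := n)).symm (e₂ (n := n)).symm (u : Matrix _ _ ℂ) * Tinv = fromBlocks 1 b 0 1) := by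
  obtain ⟨T, Tinv, h1, h2, hT, hS, hU, hB⟩ :=
    exists_tubeFrame (fun k => (w.1.embedding (dV (e.symm k).1 * dW (e.symm k).2)).re) (tw_ne_zero L e dV hdV dW hdW w hw hdV0 hdW0)
  refine ⟨T, Tinv, h1, h2, fun g hg => ?_, fun g hg => hS _ hg, fun u hu hU' => ?_, fun b hb => ?_⟩
  · exact conj_mem_UJ hT h1 ((mem_archLocal_hermD_iff L e dV hdV dW hdW w hw g).1 hg)
  · -- `ũ = u(φ)`, unitary for `diag t ⊕ −diag t`, hence `φ` skew and `b` hermitian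
    have hshape := (isUnip_blocks_iff _).1 hU'
    set φ := (Matrix.reindex (e₂ (n := n)).symm (e₂ (n := n)).symm (u : Matrix _ _ ℂ)).toBlocks₂₁
    obtain ⟨b, hb, hherm⟩ := hU φ
    refine ⟨b, hherm ?_, by rw [hshape]; exact hb⟩
    have hmem := (mem_archLocal_hermD_iff L e dV hdV dW hdW w hw u).1 hu
    rw [hshape] at hmem
    exact (unip_conjTranspose_mul_form_mul_iff (by rw [diagonal_conjTranspose]; simp [Pi.star_def]) φ).1 hmem
  · obtain ⟨φ, hskew, hφ⟩ := hB b hb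
    have hunit : (fromBlocks (1 + φ) (-φ) φ (1 - φ))ᴴ *
        fromBlocks (diagonal fun k => (((w.1.embedding (dV (e.symm k).1 * dW (e.symm k).2)).re : ℝ) : ℂ)) 0 0
          (-diagonal fun k => (((w.1.embedding (dV (e.symm k).1 * dW (e.symm k).2)).re : ℝ) : ℂ)) *
        fromBlocks (1 + φ) (-φ) φ (1 - φ) = _ :=
      (unip_conjTranspose_mul_form_mul_iff (by rw [diagonal_conjTranspose]; simp [Pi.star_def]) φ).2 hskew
    let U : Matrix (Fin (n + n)) (Fin (n + n)) ℂ := Matrix.reindex (e₂ (n := n)) (e₂ (n := n)) (fromBlocks (1 + φ) (-φ) φ (1 - φ))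
    let Uinv : Matrix (Fin (n + n)) (Fin (n + n)) ℂ :=
      Matrix.reindex (e₂ (n := n)) (e₂ (n := n)) (fromBlocks (1 - φ) φ (-φ) (1 + φ))
    have hUU : U * Uinv = 1 := by
      show Matrix.reindex _ _ _ * Matrix.reindex _ _ _ = 1
      rw [reindex_apply, reindex_apply, submatrix_mul_equiv, unip_mul_unip_neg, submatrix_one_equiv]
    have hUU' : Uinv * U = 1 := by
      show Matrix.reindex _ _ _ * Matrix.reindex _ _ _ = 1
      rw [reindex_apply, reindex_apply, submatrix_mul_equiv, unip_neg_mul_unip, submatrix_one_equiv]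
    refine ⟨⟨U, Uinv, hUU, hUU'⟩, ?_, isUnipM_reindex_unip φ, ?_⟩
    · rw [mem_archLocal_hermD_iff L e dV hdV dW hdW w hw]
      show (Matrix.reindex _ _ U)ᴴ * _ * Matrix.reindex _ _ U = _
      simp only [U, reindex_symm_reindex]
      exact hunit
    · show T * Matrix.reindex _ _ U * Tinv = _
      simp only [U, reindex_symm_reindex]
      exact hφ

end Summit.HodgeConjecture.HodgeConjecture.Cruxes.HLiu418.K2LiuHermitianTubeFrameArch
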